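import Literature.AlgebraicGeometry.Resolution.FiniteDeterminacyProofs
import HarnessLib

/-!
# Proof of Boubakri–Greuel–Markwig, Corollary 2.4 (determinacy bound by the Milnor / Tjurina number)

This file discharges the named fact `BoubakriGreuelMarkwig.Cor24` of
`Literature/AlgebraicGeometry/Resolution/FiniteDeterminacy.lean`: `theorem Cor24_holds : Cor24`.
Source: Y. Boubakri, G.-M. Greuel, T. Markwig, *Invariants of hypersurface singularities in positive
characteristic*, Rev. Mat. Complut. 25 (2012) 61–85 = arXiv:1005.4503 [BoubakriGreuelMarkwig2010], Corollary 2.4 with its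
printed proof «This follows from Remark 2.3 (c) and Theorem 2.1» (arXiv p. 7), Theorem 2.1 being the tree's ★
`Thm21_holds` (`FiniteDeterminacyProofs.lean`).

Remark 2.3 (c), verbatim: «If `μ(f) < ∞`, then `𝔪^{μ(f)} ⊆ j(f)`. If `τ(f) < ∞`, then `𝔪^{τ(f)} ⊆ tj(f)`. To see this it
suffices to show that for any ideal `I ⊴ K[[x]]` with `d = dim_K(K[[x]]/I) < ∞` we have `𝔪^d ⊆ I`. In the ring `K[[x]]/I` by
Nakayama's Lemma the descending sequence of powers `𝔪̄^k` of the maximal ideal has to be strictly descending until it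
finally becomes zero. Thus in each step the codimension of `𝔪̄^k` grows at least by one, and it can do so at most `d`
times. Thus `𝔪̄^d = 0` or equivalently `𝔪^d ⊆ I`.»  This is `maximalIdeal_pow_finrank_le` below, proved exactly so for any
local commutative `K`-algebra `A` in place of `K[[x]]` (the chain `𝔪^k·(A/I)` of `K`-subspaces of `A/I`; finite generation of
each member from finite `K`-dimension; Nakayama as Mathlib's `Submodule.eq_bot_of_le_smul_of_le_jacobson_bot` with
`𝔪 ≤ jacobson`).  Corollary 2.4 then follows from Theorem 2.1 with `k = μ(f)` resp. `k = τ(f)`: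
`𝔪^{μ+2} = 𝔪²·𝔪^μ ⊆ 𝔪²·j(f)` and `𝔪^{τ+2} ⊆ 𝔪²·tj(f) = 𝔪²⟨f⟩ + 𝔪²·j(f) ⊆ 𝔪⟨f⟩ + 𝔪²·j(f)`.

No definitions, no new facts, no `sorry`; net debt −1 (`Cor24`).
-/

noncomputable section

namespace Literature.AlgebraicGeometry.Resolution

namespace BoubakriGreuelMarkwig

open IsLocalRing

/-! ## Remark 2.3 (c): `dim_K (A/I) = d < ∞ ⇒ 𝔪^d ⊆ I` -/

section NakayamaChain

variable {K : Type*} [Field K] {A : Type*} [CommRing A] [Algebra K A] [IsLocalRing A]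

/-- **Remark 2.3 (c)** (for any local commutative `K`-algebra `A`): if `A/I` is finite-dimensional over `K`, of dimension `d`,
then `𝔪^d ⊆ I` — the chain `𝔪̄^k` in `A/I` is strictly descending until it becomes zero (Nakayama), and its codimension can grow
at most `d` times. [cite: BoubakriGreuelMarkwig2010, Remark 2.3 (c) (arXiv:1005.4503 p. 7)] -/
theorem maximalIdeal_pow_finrank_le (I : Ideal A) [Module.Finite K (A ⧸ I)] :
    maximalIdeal A ^ Module.finrank K (A ⧸ I) ≤ I := by
  classical
  haveI : IsNoetherian K (A ⧸ I) := IsNoetherian.iff_fg.mpr inferInstance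
  -- the chain `U k = 𝔪^k · (A/I)` of `A`-submodules and its `K`-subspaces `W k`
  obtain ⟨U, hU⟩ : ∃ U : ℕ → Submodule A (A ⧸ I), ∀ k, U k = (maximalIdeal A ^ k) • ⊤ := ⟨_, fun _ => rfl⟩
  have hU0 : U 0 = ⊤ := by rw [hU, pow_zero, Ideal.one_eq_top, Submodule.top_smul]
  have hUsucc : ∀ k, U (k + 1) = maximalIdeal A • U k := fun k => by
    rw [hU, hU, pow_succ', Submodule.mul_smul]
  have hUanti : ∀ k, U (k + 1) ≤ U k := fun k => by
    rw [hUsucc]; exact Submodule.smul_le_right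
  -- each `U k` is finitely generated (from finite `K`-dimension)
  have hfg : ∀ k, (U k).FG := fun k => by
    obtain ⟨s, hs⟩ := IsNoetherian.noetherian ((U k).restrictScalars K)
    refine ⟨s, le_antisymm ?_ ?_⟩
    · refine Submodule.span_le.mpr fun x hx => ?_
      have hx' : x ∈ Submodule.span K (s : Set (A ⧸ I)) := Submodule.subset_span hx
      rw [hs] at hx'
      exact hx'
    · intro x hx
      have hx' : x ∈ Submodule.span K (s : Set (A ⧸ I)) := by rw [hs]; exact hx
      exact Submodule.span_le_restrictScalars K A _ hx'
  -- Nakayama: stabilisation forces zero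
  have hstab : ∀ k, U (k + 1) = U k → U k = ⊥ := fun k h =>
    Submodule.eq_bot_of_le_smul_of_le_jacobson_bot (maximalIdeal A) (U k) (hfg k)
      (by rw [← hUsucc, h]) (maximalIdeal_le_jacobson ⊥)
  -- counting codimensions
  have hcount : ∀ k, (∃ j, j ≤ k ∧ U j = ⊥) ∨
      Module.finrank K ((U k).restrictScalars K) + k ≤ Module.finrank K (A ⧸ I) := by
    intro k
    induction k with
    | zero =>
      right
      rw [hU0, Submodule.restrictScalars_top, finrank_top, add_zero]
    | succ k ih =>
      rcases ih with ⟨j, hj, hj0⟩ | hk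
      · exact Or.inl ⟨j, by omega, hj0⟩
      · by_cases h : U (k + 1) = U k
        · exact Or.inl ⟨k, by omega, hstab k h⟩
        · right
          have hlt : (U (k + 1)).restrictScalars K < (U k).restrictScalars K :=
            lt_of_le_of_ne (fun x hx => hUanti k hx)
              (fun h' => h (Submodule.restrictScalars_injective K A (A ⧸ I) h'))
          have := Submodule.finrank_lt_finrank_of_lt hlt
          omega
  have hUμ : U (Module.finrank K (A ⧸ I)) = ⊥ := by
    rcases hcount (Module.finrank K (A ⧸ I)) with ⟨j, hj, hj0⟩ | h
    · exact le_bot_iff.mp (le_trans (antitone_nat_of_succ_le hUanti hj) (le_of_eq hj0))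
    · have h0 : Module.finrank K ((U (Module.finrank K (A ⧸ I))).restrictScalars K) = 0 := by omega
      exact (Submodule.restrictScalars_eq_bot_iff K A (A ⧸ I)).mp (Submodule.finrank_eq_zero.mp h0)
  -- conclusion
  intro x hx
  have hmem : Ideal.Quotient.mk I x ∈ U (Module.finrank K (A ⧸ I)) := by
    rw [hU]
    have h1 : Ideal.Quotient.mk I x = x • (1 : A ⧸ I) := by
      rw [Algebra.smul_def, Ideal.Quotient.algebraMap_eq, mul_one]
    rw [h1]
    exact Submodule.smul_mem_smul hx Submodule.mem_top
  rw [hUμ, Submodule.mem_bot] at hmem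
  exact Ideal.Quotient.eq_zero_iff_mem.mp hmem

end NakayamaChain

/-! ## Corollary 2.4 -/

/-- `𝔪^{d+2} = 𝔪²·𝔪^d ⊆ 𝔪²·J` from `𝔪^d ⊆ J`. [cite: BoubakriGreuelMarkwig2010, proof of Cor. 2.4 (arXiv:1005.4503 p. 7)] -/
private theorem pow_add_two_le {A : Type*} [CommRing A] [IsLocalRing A] {J : Ideal A} {d : ℕ}
    (h : maximalIdeal A ^ d ≤ J) : maximalIdeal A ^ (d + 2) ≤ maximalIdeal A ^ 2 * J := by
  rw [pow_add, mul_comm]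
  exact Ideal.mul_mono_right h

/-- **Boubakri–Greuel–Markwig, Corollary 2.4** (discharge of the named fact `Cor24`): for `K` algebraically closed of any
characteristic, `n ≥ 2`, `0 ≠ f ∈ 𝔪² ⊆ K[[x₁,…,xₙ]]`: (1) if `μ(f) < ∞` then `f` is right `(2μ(f) − ord f + 2)`-determined;
(2) if `τ(f) < ∞` then `f` is contact `(2τ(f) − ord f + 2)`-determined.  Printed proof: «This follows from Remark 2.3 (c) and
Theorem 2.1» — here `maximalIdeal_pow_finrank_le` and ★ `Thm21_holds` with `k = μ(f)` resp. `τ(f)`.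
[cite: BoubakriGreuelMarkwig2010, Cor. 2.4 (arXiv:1005.4503 p. 7)] -/
theorem Cor24_holds : Cor24 := by
  intro K _ _ n hn f hf hf2
  refine ⟨fun hμ => ?_, fun hτ => ?_⟩
  · have hle : maximalIdeal (MvPowerSeries (Fin n) K) ^ milnorNumber f ≤ jacobianIdeal f := by
      haveI : Module.Finite K (MvPowerSeries (Fin n) K ⧸ jacobianIdeal f) := hμ
      exact maximalIdeal_pow_finrank_le (K := K) (jacobianIdeal f)
    exact (Thm21_holds K n hn f (milnorNumber f) hf hf2).1 (pow_add_two_le hle)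
  · have hle : maximalIdeal (MvPowerSeries (Fin n) K) ^ tjurinaNumber f ≤ tjurinaIdeal f := by
      haveI : Module.Finite K (MvPowerSeries (Fin n) K ⧸ tjurinaIdeal f) := hτ
      exact maximalIdeal_pow_finrank_le (K := K) (tjurinaIdeal f)
    have hyp : maximalIdeal (MvPowerSeries (Fin n) K) ^ (tjurinaNumber f + 2) ≤
        maximalIdeal (MvPowerSeries (Fin n) K) * Ideal.span {f} +
          maximalIdeal (MvPowerSeries (Fin n) K) ^ 2 * jacobianIdeal f := by
      refine le_trans (pow_add_two_le hle) ?_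
      rw [tjurinaIdeal, Ideal.mul_sup, Ideal.add_eq_sup]
      exact sup_le_sup_right (Ideal.mul_mono_left (Ideal.pow_le_self two_ne_zero)) _
    exact (Thm21_holds K n hn f (tjurinaNumber f) hf hf2).2 hyp

end BoubakriGreuelMarkwig

end Literature.AlgebraicGeometry.Resolution

end
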